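import Summits.BirchSwinnertonDyer.BirchSwinnertonDyer.Theses.ClassRecordThree
import Summits.BirchSwinnertonDyer.BirchSwinnertonDyer.Theses.KolyvaginRoadThree
import Summits.BirchSwinnertonDyer.BirchSwinnertonDyer.Theorems.ClassRecordThreeVC3LZZUnitOfFact
import Summits.BirchSwinnertonDyer.Rank1Residual.Partition.AnticyclotomicControlJSWEmbAt
import Summits.BirchSwinnertonDyer.Rank1Residual.X11b.RouteR1BDPValue
import Summits.BirchSwinnertonDyer.Rank1Residual.X11b.CastellaErratumVersionOfRecord
import Summits.BirchSwinnertonDyer.Rank1Residual.X11b.Three.StepLHalves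
import Literature.NumberTheory.EllipticCurves.UnrIntegersUnits
import Literature.NumberTheory.EllipticCurves.UnrIntegersSqrt
import Literature.NumberTheory.QuadraticFields.FundamentalDiscriminant
import Literature.NumberTheory.QuadraticFields.HeegnerCondition
import HarnessLib

/-!
# Crux `ValueContinuityAtThree` (VC₃, stmt-BirchSwinnertonDyer-19493; route `ClassRecordThree`, cell `bsd-stepL`) BY NAME
# modulo ONE refereed Literature fact — line `lzz`, part 3: the composition

Cell `bsd-stepL` (run/shared/lean/pub/bsd-stepL/), seat `bsd-stepL-thmc-p1x` (WIDTH-LEVER second prover lane on crux 19493,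
g0, 2026-08-27), `--supports stmt-BirchSwinnertonDyer-19493 --as helper` (line `lzz` is not the registered skeleton of 19493 —
the registered one is birth v1, stubs `stub_vc3_split ∕ _nonsplit` —, so no stub credit is claimed; the crux decl itself is
concluded). Parts 1–2: `Theorems/ClassRecordThreeVC3LZZUnitRescale.lean` (p528118, the bsd-eis rescale with the unit explicit),
`Theorems/ClassRecordThreeVC3LZZUnitOfFact.lean` (the FACT-level display with the unit identified).

HONEST FRAMING: THEOREMS ONLY (0 sorry, 0 def); nothing booked; O2 ∕ B10 stay as labelled; no node, label or census count
moves (T7); BSD(E,3) is proved for no class. The crux theorems are CONDITIONAL (`conditional-result`) on exactly ONE named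
Literature fact, `LiuZhangZhang2018.thm151_thm153_modularCurve_heegnerVector` (Liu–Zhang–Zhang, *A p-adic Waldspurger formula*,
Duke Math. J. 167 (2018) Thm 1.5.1 ∧ Rem 1.1.2 ∧ Thm 1.5.3; REFEREED; typed p509230 by cell `bsd-littype`, readings audited
pub/bsd-eis LIT-DOSSIER §82/§86) — no cell-posited residual (no `HsiehDescentAt₃`, no leaf 19405, no value reciprocity 19281,
no THEOREM C memo) enters.

## What this file proves

* `lzz_unitExport_of_thm151_thm153` — stub `stub_unitExport` of line `lzz` (cgshw g15 skeleton
  `pub/bsd-eis/cgshw-files/g15/crux19493-Lines-lzz.lean`, sha16 eca91f3bff7d0550) VERBATIM with the fact as hypothesis: at every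
  datum of VC₃, `Ω_K = 1`, `Ω_p ≠ 0`, `s = ±1` with Castella's display → `s·ι'⁻¹(2)·ι'⁻¹(c_M)⁻²·ι'⁻¹(√|d_K|)⁻¹·((1 − a₃·3⁻¹)·
  log_ω P)²` — part 2 read at `e := embAt K 3 𝔭` with the crux's dictionary (Mult ⟸ `ClassX11b`; `3 ∣ N`, `9 ∤ N` ⟸ Mult;
  `3` split ⟸ Heegner; `d_K < −4` ⟸ `Odd d_K` ∧ `3 ∤ d_K` ∧ Stickelberger; `InducesPrime` verbatim; `logOmega = padicLogOmega`;
  exactly as in p525241).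
* **`valueContinuityAtThree_of_thm151_thm153 : LiuZhangZhang2018.thm151_thm153_modularCurve_heegnerVector →
  ClassRecordThree.ValueContinuityAtThree`** — THE CRUX BY NAME: the identified unit lies in `R₀ = unrIntegers 3` (`2, s ∈ ℤ`;
  `c_M ∈ ℤ` with `3 ∤ c_M` so its inverse is in `R₀` by `unrIntegers.inv_mem_of_norm_eq_one`; `ι'⁻¹(√|d_K|) = ±x` for the square
  root `x ∈ R₀` of the squarefree `|d_K|` prime to `3` — cgshw's [M] `exists_sq_eq_natCast_mem_unrIntegers_of_squarefree`,
  p526401; `|d_K|` squarefree by `Quadratic.isFundamentalDiscriminant_discr` since `d_K` is odd, `3 ∤ d_K` by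
  `SatisfiesHeegnerHypothesis.not_dvd_discr`) and has norm `1`, hence is a unit (`unrIntegers.isUnit_iff_norm_eq_one`); with it
  the display of `lzz_unitExport_of_thm151_thm153` is VC₃'s display verbatim. Composition = cgshw's `ValueContinuityAtThree_of`.
* The `KolyvaginRoadThree` copy of 19493 is the same statement (`kolyvaginRoadThree_valueContinuityAtThree_iff_classRecordThree`,
  p436261, `Iff.rfl`); its one-line corollary from the fact is `Theorems/KolyvaginRoadThreeValueContinuityAtThreeOfLZZ.lean` (p532204).
* §3 (appended): `valueContinuityAtThree_of_lzzWaldspurgerHeegner` ∕ `kolyvaginRoadThree_valueContinuityAtThree_of_lzzWaldspurgerHeegner`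
  — the routes' own by-name support item 20448 `LZZWaldspurgerHeegner` ⟹ crux 19493, on both @3 routes (the glue shape for the aside).

References: [LiuZhangZhang2018] Duke Math. J. 167 (2018) Thm 1.5.1, Rem 1.1.2, Thm 1.5.3 (pp. 745–749); [Castella2018] Thm 3.1–3.2
(arXiv:1704.06608 pp. 8–9; display and `R₀` shapes only, nothing asserted at `p = 3`); [IrelandRosen1990] Prop 6.3.2; pub/bsd-eis
cgshw MEMO-18 §5, MEMO-19 §8; pub/bsd-stepL RULING 17 (C), PROOF-BDP §20 (THEOREM C: the unit there is `κ⁻¹c_E⁻²(sign)²` — same shape).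
-/

set_option autoImplicit false
-- the Theorems namespace `Summit.BirchSwinnertonDyer.BirchSwinnertonDyer.Theorems` repeats the summit name by design (D-0017)
set_option linter.dupNamespace false

noncomputable section

open scoped Classical Topology

open Filter WeierstrassCurve NumberField IsDedekindDomain Field PowerSeries
  Literature.NumberTheory.EllipticCurves Literature.NumberTheory.EllipticCurves.ModularForms
  Literature.NumberTheory.EllipticCurves.Rank1Residual
  Literature.NumberTheory.GaloisRepresentations Literature.NumberTheory.GaloisCohomology
  Summit.BirchSwinnertonDyer.Rank1Residual Summit.BirchSwinnertonDyer.Rank1Residual.X11b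
  Summit.BirchSwinnertonDyer.Rank1Residual.X11b.Halves
  Summit.BirchSwinnertonDyer.Rank1Residual.X11b.Three
  Summit.BirchSwinnertonDyer.BirchSwinnertonDyer.Theses

namespace Summit.BirchSwinnertonDyer.BirchSwinnertonDyer.Theorems

/-! ## §1 Stub `stub_unitExport` of line `lzz`, from the fact -/

/-- **`stub_unitExport` of line `lzz` (crux 19493) with the LZZ fact as hypothesis**: at every X11b@3 classical datum of VC₃,
from the refereed Liu–Zhang–Zhang fact, Castella's display (at `Ω_K = 1`, some `Ω_p ≠ 0`) tends to
`s·ι'⁻¹(2)·ι'⁻¹(c_M)⁻²·ι'⁻¹(√|d_K|)⁻¹·((1 − a₃·3⁻¹)·log_{ω_E} P)²` with `s = ±1`. Part 2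
(`LZZUnit.exists_continuousDisplayUnit_of_thm151_thm153`) at `e := embAt K 3 𝔭` through the crux's dictionary. CONDITIONAL on
the named fact `hF`; nothing booked. [cite: LiuZhangZhang2018, Thm. 1.5.1 and Thm. 1.5.3 (Duke Math. J. 167 pp. 748–749)] -/
theorem lzz_unitExport_of_thm151_thm153 (hF : LiuZhangZhang2018.thm151_thm153_modularCurve_heegnerVector) :
    ∀ (W : WeierstrassCurve ℚ) [W.IsElliptic] [W.IsGloballyMinimal],
    ∀ (N : ℕ) [NeZero N] (K : Type) [Field K] [NumberField K] (Dt : ModularParametrizationData W N)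
      (H : HeegnerDatum N (NumberField.discr K)) (ι : K →+* ℂ) (P : (W.baseChange K).toAffine.Point),
      ClassX11b W 3 → Surj W 3 → W.conductorNorm ℤ = N → IsImaginaryQuadratic K →
      Odd (NumberField.discr K) → SatisfiesHeegnerHypothesis N K →
      (W.quadraticTwist (NumberField.discr K : ℚ)).entireLFunction 1 ≠ 0 →
      WeierstrassCurve.Affine.Point.map ι.toRatAlgHom P = heegnerPointComplex Dt H →
      ¬ (3 : ℤ) ∣ Dt.c → ¬ IsOfFinAddOrder P →
      ∀ (κ : ZpExtension K 3), κ.IsAnticyclotomic →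
        ∀ (γ : Field.absoluteGaloisGroup K) [Fact (κ.IsTopGenerator γ)]
          (𝔭 : HeightOneSpectrum (𝓞 K)) (h𝔭 : ((3 : ℕ) : 𝓞 K) ∈ 𝔭.asIdeal)
          (he : 𝔭.asIdeal.ramificationIdx (𝓞 ℚ) = 1) (hf : 𝔭.asIdeal.inertiaDeg (𝓞 ℚ) = 1),
          ∀ (f : CuspForm (CongruenceSubgroup.Gamma0 N) 2), IsNewformOf W f →
            ∀ (ι' : PadicAlgCl 3 ≃+* ℂ), InducesPrime ι' 𝔭 →
              ∃ (ΩK : ℂ) (Ωp : ℂ_[3]) (s : ℤ), ΩK ≠ 0 ∧ Ωp ≠ 0 ∧ (s = 1 ∨ s = -1) ∧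
                ∀ (φ : ℕ → HeckeCharacter K) (n : ℕ → ℕ) (r : ℕ → FramedGaloisRep K (PadicAlgCl 3) 1),
                  (∀ k, 0 < n k) → (∀ k (v : HeightOneSpectrum (𝓞 K)), (φ k).IsUnramifiedAt v) →
                  (∀ k, (φ k).HasInfinityType (fun _ ↦ (n k : ℤ)) (fun _ ↦ -(n k : ℤ))) →
                  (∀ k, IsPAdicAvatarOf ι' (φ k) (r k)) → (∀ k, FactorsThroughZp κ (r k)) →
                  Tendsto (fun k ↦ avatarValueAt (r k) γ) atTop (𝓝 1) →
                  Tendsto (fun k ↦ ((ι'.symm (bdpInterpolationValue 3 f 𝔭 (φ k) (n k) ΩK) :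
                    PadicAlgCl 3) : ℂ_[3]) * Ωp ^ (4 * n k)) atTop
                    (𝓝 ((s : ℂ_[3]) * ((ι'.symm (2 : ℂ) : PadicAlgCl 3) : ℂ_[3]) *
                      ((((ι'.symm ((Dt.c : ℤ) : ℂ) : PadicAlgCl 3) : ℂ_[3])) ^ 2)⁻¹ *
                      (((ι'.symm ((Real.sqrt |(NumberField.discr K : ℝ)| : ℝ) : ℂ) : PadicAlgCl 3) : ℂ_[3]))⁻¹ *
                      (algebraMap ℚ_[3] ℂ_[3] (((1 : ℚ_[3]) - ((W.LFunction 3 : ℤ) : ℚ_[3]) *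
                        (3 : ℚ_[3])⁻¹) * logOmega W 3 (embAt K 3 𝔭 h𝔭 he hf) P)) ^ 2)) := by
  intro W _ _ N _ K _ _ Dt H ι P hX _hsurj hN hK hodd hHN _hLt hP hcM _hPinf κ hκ γ hγ 𝔭 h𝔭 he hf f hfW ι' hι'
  have hp : (3 : ℕ).Prime := Fact.out
  have hmult : W.HasMultiplicativeReductionAtPrime 3 := hX.2.2.1
  have hpN : 3 ∣ N := hN ▸ X11b.dvd_conductorNorm_of_mult (W := W) hmult
  have hp2N : ¬ 3 ^ 2 ∣ N := hN ▸ X2.not_sq_dvd_conductorNorm_of_mult W 3 hmult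
  have hsplit : ((Ideal.span {((3 : ℕ) : ℤ)}).primesOver (𝓞 K)).ncard = 2 := hHN 3 hp hpN
  have hdisc : ¬ ((3 : ℕ) : ℤ) ∣ NumberField.discr K :=
    Literature.SatisfiesHeegnerHypothesis.not_dvd_discr hK.1 hHN hp hpN
  have hneg : NumberField.discr K < 0 := IsImaginaryQuadratic.discr_neg hK
  have hmod4 := Literature.NumberTheory.QuadraticFields.Quadratic.discr_emod_four (K := K) hK.1
  have hd4 : NumberField.discr K < -4 := by
    obtain ⟨m, hm⟩ := hodd
    have h3 : NumberField.discr K ≠ -3 := fun h ↦ hdisc ⟨-1, by rw [h]; norm_num⟩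
    omega
  have hemb : ∀ k : 𝓞 K, k ∈ 𝔭.asIdeal ↔ ‖embAt K 3 𝔭 h𝔭 he hf (k : K)‖ < 1 :=
    mem_asIdeal_iff_norm_embAt_lt_one 𝔭 h𝔭 he hf
  obtain ⟨Ωp, s, hΩp, hs, hcont⟩ :=
    LZZUnit.exists_continuousDisplayUnit_of_thm151_thm153 hF ι' W K 𝔭 κ γ Dt H ι (embAt K 3 𝔭 h𝔭 he hf) P f
      hN hpN hp2N hK hd4 hsplit h𝔭 hι' hHN hκ hγ.out hfW hcM hP hemb
  refine ⟨1, Ωp, s, one_ne_zero, hΩp, hs, fun φ n r hn hunr hinf hav hfac hlim ↦ ?_⟩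
  have h := hcont φ n r hn hunr hinf hav hfac hlim
  rwa [← R1.logOmega_eq_padicLogOmega] at h

/-! ## §2 The crux BY NAME -/

/-- **Crux `ClassRecordThree.ValueContinuityAtThree` (stmt-BirchSwinnertonDyer-19493) from the ONE refereed fact
`LiuZhangZhang2018.thm151_thm153_modularCurve_heegnerVector`.** The unit `u = s·ι'⁻¹(2)·ι'⁻¹(c_M)⁻²·ι'⁻¹(√|d_K|)⁻¹` of §1 lies
in `R₀ = unrIntegers 3` and has norm `1`, hence is a unit of `R₀`; with it §1's display is VC₃'s display verbatim
(composition = line `lzz`'s `ValueContinuityAtThree_of`, cgshw g15, with [M] = `exists_sq_eq_natCast_mem_unrIntegers_of_squarefree`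
p526401). CONDITIONAL (`conditional-result`) on the named fact `hF` — refereed, Duke Math. J. 167 (2018); no other input;
nothing booked; no label or count moves; BSD(E,3) is proved for no class.
[cite: LiuZhangZhang2018, Thm. 1.5.1 and Remark 1.1.2 and Thm. 1.5.3 (Duke Math. J. 167 (2018) pp. 745–749)]
[cite: IrelandRosen1990, Prop. 6.3.2 (√q ∈ ℤ[ζ_q] ⊂ R₀ via the quadratic Gauss sum)] -/
theorem valueContinuityAtThree_of_thm151_thm153 (hF : LiuZhangZhang2018.thm151_thm153_modularCurve_heegnerVector) :
    ClassRecordThree.ValueContinuityAtThree := by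
  intro W _ _ N _ K _ _ Dt H ι P hX hsurj hN hK hodd hHN hLt hP hcM hPinf κ hκ γ hγ 𝔭 h𝔭 he hf f hfW ι' hι'
  have hp : (3 : ℕ).Prime := Fact.out
  obtain ⟨ΩK, Ωp, s, hΩK, hΩp, hs, hcont⟩ := lzz_unitExport_of_thm151_thm153 hF W N K Dt H ι P hX hsurj hN hK hodd hHN
    hLt hP hcM hPinf κ hκ γ 𝔭 h𝔭 he hf f hfW ι' hι'
  -- the embedding `ι'⁻¹ : ℂ → ℂ₃` as a ring map
  set em : ℂ →+* ℂ_[3] := (algebraMap (PadicAlgCl 3) ℂ_[3]).comp ι'.symm.toRingHom with hem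
  have hem' : ∀ z : ℂ, ((ι'.symm z : PadicAlgCl 3) : ℂ_[3]) = em z := fun z ↦ rfl
  -- `3 ∣ N`, `3 ∤ d_K`, `|d_K|` squarefree
  have hmult : W.HasMultiplicativeReductionAtPrime 3 := hX.2.2.1
  have hpN : 3 ∣ N := hN ▸ X11b.dvd_conductorNorm_of_mult (W := W) hmult
  have hdisc : ¬ ((3 : ℕ) : ℤ) ∣ NumberField.discr K :=
    Literature.SatisfiesHeegnerHypothesis.not_dvd_discr hK.1 hHN hp hpN
  have hsqf : Squarefree (NumberField.discr K).natAbs := by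
    rcases Literature.NumberTheory.QuadraticFields.Quadratic.isFundamentalDiscriminant_discr (K := K) hK.1 with
      ⟨-, hsq, -⟩ | ⟨h4, -, -⟩
    · exact Int.squarefree_natAbs.mpr hsq
    · exfalso
      obtain ⟨m, hm⟩ := hodd
      obtain ⟨c, hc⟩ := h4
      omega
  have hcop : ¬ 3 ∣ 2 * (NumberField.discr K).natAbs := by
    intro h
    rcases (Nat.Prime.dvd_mul hp).mp h with h2 | h2
    · omega
    · exact hdisc (Int.natCast_dvd.mpr h2)
  -- the square root of `|d_K|` in `R₀` ([M], p526401)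
  obtain ⟨x, hxR, hx2⟩ := exists_sq_eq_natCast_mem_unrIntegers_of_squarefree 3 (NumberField.discr K).natAbs hsqf hcop
  set δ : ℂ_[3] := em ((Real.sqrt |(NumberField.discr K : ℝ)| : ℝ) : ℂ) with hδ
  have hδ2 : δ ^ 2 = ((NumberField.discr K).natAbs : ℂ_[3]) := by
    have hcast : ((|(NumberField.discr K : ℝ)| : ℝ) : ℂ) = (((NumberField.discr K).natAbs : ℕ) : ℂ) := by
      rw [Nat.cast_natAbs, ← Complex.ofReal_intCast, Int.cast_abs]
    rw [hδ, ← map_pow, ← Complex.ofReal_pow, Real.sq_sqrt (abs_nonneg _), hcast, map_natCast]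
  have hδR : δ ∈ unrIntegers 3 := by
    have h := hδ2.trans hx2.symm
    rcases sq_eq_sq_iff_eq_or_eq_neg.mp h with h' | h'
    · rw [h']; exact hxR
    · rw [h']; exact neg_mem hxR
  have hδ1 : ‖δ‖ = 1 := by
    rw [hδ]; exact X2.PNewDisplay.norm_map_sqrt_discr_eq_one em hdisc
  -- the Manin constant and `2` are units of `R₀`
  have hc1 : ‖em ((Dt.c : ℤ) : ℂ)‖ = 1 := X2.norm_map_intCast_eq_one em hcM
  have hcR : em ((Dt.c : ℤ) : ℂ) ∈ unrIntegers 3 := by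
    rw [map_intCast]; exact intCast_mem_unrIntegers _
  have h2R : em (2 : ℂ) ∈ unrIntegers 3 := by
    rw [map_ofNat]; exact_mod_cast intCast_mem_unrIntegers (p := 3) 2
  have h21 : ‖em (2 : ℂ)‖ = 1 := by
    rw [show (2 : ℂ) = ((2 : ℕ) : ℂ) by norm_num]
    exact X2.PNewDisplay.norm_map_natCast_eq_one em (by decide)
  have hsR : ((s : ℂ_[3])) ∈ unrIntegers 3 := intCast_mem_unrIntegers s
  have hs1 : ‖(s : ℂ_[3])‖ = 1 := by rcases hs with h | h <;> simp [h]
  -- the identified unit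
  set u : ℂ_[3] := (s : ℂ_[3]) * em (2 : ℂ) * ((em ((Dt.c : ℤ) : ℂ)) ^ 2)⁻¹ * δ⁻¹ with hu
  have huR : u ∈ unrIntegers 3 := by
    refine mul_mem (mul_mem (mul_mem hsR h2R) ?_) (unrIntegers.inv_mem_of_norm_eq_one hδR hδ1)
    exact unrIntegers.inv_mem_of_norm_eq_one (pow_mem hcR 2) (by rw [norm_pow, hc1, one_pow])
  have hu1 : ‖u‖ = 1 := by
    rw [hu, norm_mul, norm_mul, norm_mul, norm_inv, norm_inv, norm_pow, hs1, h21, hc1, hδ1]; norm_num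
  have hunit : IsUnit (⟨u, huR⟩ : unrIntegers 3) := (unrIntegers.isUnit_iff_norm_eq_one _).mpr hu1
  refine ⟨ΩK, Ωp, hunit.unit, hΩK, hΩp, fun φ n r hn hunr hinf hav hfac hlim ↦ ?_⟩
  have hcoe : ((hunit.unit : unrIntegers 3) : ℂ_[3]) = u := by
    rw [IsUnit.unit_spec]
  rw [hcoe, hu, hδ, ← hem', ← hem', ← hem']
  exact hcont φ n r hn hunr hinf hav hfac hlim

/-! ## §3 (appended 2026-08-27, same seat) The routes' own vocabulary: support 20448 `LZZWaldspurgerHeegner` ⟹ crux 19493,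
on both @3 routes

Since K2@3 rev 27 ∕ KOLY rev 28 («LZZ DOWN», plan g32 RULING 18 (B)) both @3 routes carry the by-name PUB support
`LZZWaldspurgerHeegner := LiuZhangZhang2018.thm151_thm153_modularCurve_heegnerVector` (item 20448) as a `closes` binder and 19493
is an ASIDE. The two one-liners below are line `lzz`'s result read at the routes' own support decl (it unfolds to the fact) —
the exact glue shape «item 20448 ⟹ item 19493» a planner needs to close or re-point the aside under 20448; the Kolyvagin road's
decl of 19493 is the `ClassRecordThree` one verbatim (`kolyvaginRoadThree_valueContinuityAtThree_iff_classRecordThree`, p436261). -/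

/-- **Route `ClassRecordThree`: support `LZZWaldspurgerHeegner` (20448) ⟹ crux `ValueContinuityAtThree` (19493)** —
`valueContinuityAtThree_of_thm151_thm153` read at the route's by-name support (which unfolds to the LZZ fact). An implication
between two route decls; the support is a refereed, undischarged (XL) Literature fact, so 19493 stays conditional on it exactly
as the routes' `closes` are. [cite: LiuZhangZhang2018, Thm. 1.5.1 and Remark 1.1.2 and Thm. 1.5.3 (Duke Math. J. 167 (2018) pp. 745–749)] -/
theorem valueContinuityAtThree_of_lzzWaldspurgerHeegner (h : ClassRecordThree.LZZWaldspurgerHeegner) :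
    ClassRecordThree.ValueContinuityAtThree :=
  valueContinuityAtThree_of_thm151_thm153 h

/-- **Route `KolyvaginRoadThree`: support `LZZWaldspurgerHeegner` (20448) ⟹ crux `ValueContinuityAtThree` (19493)** — the same
on the Kolyvagin road (both decls are the `ClassRecordThree` ones verbatim; definitional transport).
[cite: LiuZhangZhang2018, Thm. 1.5.1 and Remark 1.1.2 and Thm. 1.5.3 (Duke Math. J. 167 (2018) pp. 745–749)] -/
theorem kolyvaginRoadThree_valueContinuityAtThree_of_lzzWaldspurgerHeegner
    (h : KolyvaginRoadThree.LZZWaldspurgerHeegner) : KolyvaginRoadThree.ValueContinuityAtThree := by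
  unfold KolyvaginRoadThree.ValueContinuityAtThree
  exact valueContinuityAtThree_of_thm151_thm153 h

end Summit.BirchSwinnertonDyer.BirchSwinnertonDyer.Theorems

end
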